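import Literature.Probability.RandomPlanarGeometry.SLERestrictionProcessesKappa
import Literature.Probability.RandomPlanarGeometry.LoewnerImageDriverStep
import HarnessLib

/-!
# The image driving function `W̃_t = W_t + L_A − L_{B_t}` as a functional of the driving path

[LSW] 2003 §5 (locality/restriction engine): along the SLE_κ hulls `K_t` and a `*`-hull `A` not yet
reached, `B_t = g_t(A) − W_t = slidHull W A t` and the image driving value is
`W̃_t = h_t(W_t) + (normalisation) = W_t + L_A − L_{B_t}` with `L_B = starShift B` (the constant term of
the canonical map `E_B(z) = z + L_B + O(1/z)`, StarHullCanonical.lean). This file introduces the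
PATH FUNCTIONALS (on `C(ℝ≥0, ℝ)`, driver `drvK κ υ = √κ (υ − υ 0)` of SLERestrictionProcessesKappa.lean)
consumed by the conditional one-step estimates and the martingale assembly of the locality proof:

* `LFnK κ A t υ = L_{B_t}(υ) 𝟙{alive at t}` — the analogue of `DFnK` (`Φ'` replaced by `L`);
* `imageDrvFnK κ A t υ = W_t(υ) − LFnK κ A t υ` — the image driving functional minus the constant `L_A`;

with their defining case analysis (`LFnK_eq`, `LFnK_of_alive`, `LFnK_of_not_alive`,
`imageDrvFnK_of_alive`), the value at time `0` (`LFnK_zero`, `imageDrvFnK_zero`: `B_0 = A`), and the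
increment identity on alive paths, `imageDrvFnK (u+r) − imageDrvFnK u = Loewner.imageDriverStep (B_u) U r`
for the shifted driver `U = W_{u+·} − W_u` (`imageDrvFnK_add_sub`, via `slidHull_add`), which is the
form in which the deterministic one-step expansion `Loewner.abs_imageDriverStep_sub_model_le`
(LoewnerImageDriverStep.lean) and the stochastic one-step bounds (SLEImageDriverOneStep*.lean) apply.
Measurability of `LFnK` (via continuity of `L` along dyadic outer hulls) is the sequel
`SLEImageDriverMeasurable.lean`. No named fact; two definitions with bodies.

## References

* [LSW] 2003, §5. [LawlerSchrammWerner2003Restriction]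
* G. F. Lawler (2005), §4.6.1 (W̃, Prop. 4.40–4.41). [Lawler2005]
-/

noncomputable section

open Set Filter Metric Function
open _root_.Complex _root_.Topology
open scoped NNReal

namespace Literature.Probability.RandomPlanarGeometry

open Loewner

variable {κ : ℝ≥0} {A : Set ℂ} {t : ℝ≥0}

/-- **`L_{B_t} 𝟙{alive at t}`** as a functional of the path: the constant term of the canonical map of
the slid hull `B_t = slidHull (drvK κ υ) A t`, set to `0` once the closed hulls have met `A`.
[cite: LawlerSchrammWerner2003Restriction, §5 (h_t, W̃_t)] -/
def LFnK (κ : ℝ≥0) (A : Set ℂ) (t : ℝ≥0) (υ : C(ℝ≥0, ℝ)) : ℝ :=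
  {υ : C(ℝ≥0, ℝ) | Disjoint (closedHull (drvK κ υ) t) A}.indicator
    (fun υ ↦ (starShift (slidHull (drvK κ υ) A t)).re) υ

/-- **The image driving functional minus `L_A`**: `W_t − L_{B_t} 𝟙{alive}` (so that
`W̃_t = imageDrvFnK κ A t υ + L_A` on alive paths). [cite: LawlerSchrammWerner2003Restriction, §5 (W̃_t = h_t(W_t))] -/
def imageDrvFnK (κ : ℝ≥0) (A : Set ℂ) (t : ℝ≥0) (υ : C(ℝ≥0, ℝ)) : ℝ :=
  drvK κ υ t - LFnK κ A t υ

/-- Case analysis of `LFnK`. [folklore] -/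
theorem LFnK_eq (κ : ℝ≥0) (A : Set ℂ) (t : ℝ≥0) (υ : C(ℝ≥0, ℝ)) :
    (Disjoint (closedHull (drvK κ υ) t) A → LFnK κ A t υ = (starShift (slidHull (drvK κ υ) A t)).re) ∧
      (¬ Disjoint (closedHull (drvK κ υ) t) A → LFnK κ A t υ = 0) := by
  constructor
  · intro h
    have hm : υ ∈ {υ : C(ℝ≥0, ℝ) | Disjoint (closedHull (drvK κ υ) t) A} := h
    rw [LFnK, indicator_of_mem hm]
  · intro h
    have hm : υ ∉ {υ : C(ℝ≥0, ℝ) | Disjoint (closedHull (drvK κ υ) t) A} := h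
    rw [LFnK, indicator_of_notMem hm]

/-- `LFnK` on an alive path. [folklore] -/
theorem LFnK_of_alive {υ : C(ℝ≥0, ℝ)} (h : Disjoint (closedHull (drvK κ υ) t) A) :
    LFnK κ A t υ = (starShift (slidHull (drvK κ υ) A t)).re :=
  (LFnK_eq κ A t υ).1 h

/-- `LFnK` on a dead path. [folklore] -/
theorem LFnK_of_not_alive {υ : C(ℝ≥0, ℝ)} (h : ¬ Disjoint (closedHull (drvK κ υ) t) A) :
    LFnK κ A t υ = 0 :=
  (LFnK_eq κ A t υ).2 h

/-- `imageDrvFnK` on an alive path: `W_t − L_{B_t}`. [folklore] -/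
theorem imageDrvFnK_of_alive {υ : C(ℝ≥0, ℝ)} (h : Disjoint (closedHull (drvK κ υ) t) A) :
    imageDrvFnK κ A t υ = drvK κ υ t - (starShift (slidHull (drvK κ υ) A t)).re := by
  rw [imageDrvFnK, LFnK_of_alive h]

/-- `imageDrvFnK` on a dead path: `W_t`. [folklore] -/
theorem imageDrvFnK_of_not_alive {υ : C(ℝ≥0, ℝ)} (h : ¬ Disjoint (closedHull (drvK κ υ) t) A) :
    imageDrvFnK κ A t υ = drvK κ υ t := by
  rw [imageDrvFnK, LFnK_of_not_alive h, sub_zero]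

/-- At time `0` the slid hull of a `*`-hull is the hull itself (`g_0 = id` off `W_0 = 0 ∉ A`);
private copy of `slidHull_drvK_zero` of SLERestrictionMartingaleExistsKappa.lean (not imported here).
[folklore] -/
private theorem slidHull_drvK_zero_aux (κ : ℝ≥0) (hA : IsStarHull A) (υ : C(ℝ≥0, ℝ)) :
    slidHull (drvK κ υ) A 0 = A := by
  have hW := continuous_drvK κ υ
  have h0 : ∀ a ∈ A, map (drvK κ υ) 0 a = a := fun a ha ↦
    map_zero_apply hW (by rw [drvK_zero, ofReal_zero]; exact fun h ↦ hA.2 (h ▸ ha))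
  ext w
  simp only [mem_slidHull_iff, drvK_zero, ofReal_zero, sub_zero]
  constructor
  · rintro ⟨a, ha, rfl⟩; rw [h0 a ha]; exact ha
  · intro hw; exact ⟨w, hw, h0 w hw⟩

/-- `LFnK` at time `0` is `L_A` (for a `*`-hull `A`: alive at `0`). [folklore] -/
theorem LFnK_zero (hA : IsStarHull A) (υ : C(ℝ≥0, ℝ)) : LFnK κ A 0 υ = (starShift A).re := by
  rw [LFnK_of_alive (disjoint_closedHull_zeroK (κ := κ) hA υ), slidHull_drvK_zero_aux κ hA]

/-- `imageDrvFnK` at time `0` is `−L_A` (so that `W̃_0 = 0`). [folklore] -/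
theorem imageDrvFnK_zero (hA : IsStarHull A) (υ : C(ℝ≥0, ℝ)) : imageDrvFnK κ A 0 υ = -(starShift A).re := by
  rw [imageDrvFnK, LFnK_zero hA, drvK_zero, zero_sub]

/-- **The increment of the image driving functional over an alive step is the one-step image driving
increment** of LoewnerImageDriverStep.lean: for `u, u + r` both alive,
`imageDrvFnK (u+r) − imageDrvFnK u = Loewner.imageDriverStep (B_u) U r` with the shifted driver
`U = W_{u+·} − W_u` (`slidHull_add`: `B_{u+r} = slidHull U (B_u) r`).
[cite: LawlerSchrammWerner2003Restriction, §5 (the step from t to t + dt)] -/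
theorem imageDrvFnK_add_sub (hA : IsStarHull A) {υ : C(ℝ≥0, ℝ)} {u r : ℝ≥0}
    (hu : Disjoint (closedHull (drvK κ υ) u) A) (hur : Disjoint (closedHull (drvK κ υ) (u + r)) A) :
    imageDrvFnK κ A (u + r) υ - imageDrvFnK κ A u υ =
      imageDriverStep (slidHull (drvK κ υ) A u) (fun s ↦ drvK κ υ (u + s) - drvK κ υ u) r := by
  have hW := continuous_drvK κ υ
  have hadd : slidHull (drvK κ υ) A (u + r) =
      slidHull (fun s ↦ drvK κ υ (u + s) - drvK κ υ u) (slidHull (drvK κ υ) A u) r :=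
    slidHull_add hW (fun a ha ↦ lt_swallowingTime_of_alive hA hur ha)
  rw [imageDrvFnK_of_alive hur, imageDrvFnK_of_alive hu, imageDriverStep, hadd]
  ring

/-- `|imageDrvFnK| ≤ |W_t| + |L_{B_t}| 𝟙{alive}` — a crude bound useful for integrability.
[folklore] -/
theorem abs_imageDrvFnK_le (κ : ℝ≥0) (A : Set ℂ) (t : ℝ≥0) (υ : C(ℝ≥0, ℝ)) :
    |imageDrvFnK κ A t υ| ≤ |drvK κ υ t| + |LFnK κ A t υ| := by
  rw [imageDrvFnK]; exact abs_sub _ _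

end Literature.Probability.RandomPlanarGeometry

end
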